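import Literature.NumberTheory.EllipticCurves.Rank1Residual.Typed.X11
import Literature.NumberTheory.EllipticCurves.KolyvaginShaIndexBound
import Literature.NumberTheory.EllipticCurves.ShaRestrictionIndex
import HarnessLib

/-!
# The whole output from a finite certificate `Ш(E/ℚ)[p] = 0` at a pair with `p ∤ #Ш_an`; Kolyvagin's index certificate (cell `b2b-bsdres`)

HONEST FRAMING (run/shared/lean/b2b/bsd-rank1-residual/, verbatim): the goal of the cell is to
DELETE the COMBINATION-SHAPED residual classes for ALL analytic-rank `≤ 1` elliptic curves over `ℚ`
— "full BSD formula for every rank `≤ 1` curve in class C" assembled STRICTLY from published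
theorems — so that the rank-`≤ 1` remainder becomes exactly the CONSTRUCTION-SHAPED classes, which
are TYPED (missing-input `Prop`s), NOT attempted. This is not "finishing BSD".

Theorems only (no definition, no new named fact). Companion of `Typed/CasselsLowerBound.lean`
(x11b gen 3: the LOWER half at a rank-`0` pair from the certificate `Ш(E)[p] ≠ 0`) and of
`Typed/WuthrichUpperBound.lean`.

**What this file records.** At a pair `(E, p)` of analytic rank `≤ 1` where the analytic order of
`Ш` is a `p`-ADIC UNIT — `#Ш(E/ℚ)_an = q ∈ ℚ` with `ord_p q = 0`, i.e. the BSD prediction at `p` is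
"`p ∤ #Ш(E/ℚ)`" — the typed missing output `MissingPPartAt W p` of `Typed/Basic.lean` (Miller's last
clause, `ord_p #Ш_an = ord_p #Ш`) is NOT a missing theorem but a FINITE CERTIFICATE: it is
EQUIVALENT to `Ш(E/ℚ)[p] = 0` (`missingPPartAt_iff_noPTorsion_of_shaAn_unit`; `Ш` is finite by
Gross–Zagier–Kolyvagin, bsd.S17, binder `hGZK`). Such a certificate is the output, per curve, of
* Kolyvagin's theorem with a Heegner index prime to `p` — V. A. Kolyvagin, *Euler systems* (1990)
  Thm. A as printed by McCallum, LMS LN 153 (1991) §1 p. 296 and Gross, ibid. Thm. 1.3 / Prop. 2.1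
  (2): for an odd prime `p` with `ρ̄_{E,p}` onto `GL₂(𝔽_p)` and an imaginary quadratic Heegner field
  `K` whose Heegner point `y_K` has infinite order, `ord_p #Ш(E/K) ≤ 2 ord_p [E(K) : ℤ y_K]`
  (tree NAMED FACT `Kolyvagin1990_padicValNat_card_sha_le`, PUBLISHED; finiteness of `Ш(E/K)` is
  the tree fact `kolyvagin`), so `p ∤ [E(K) : ℤ y_K]` gives `Ш(E/K)[p] = 0`, and restriction
  `Ш(E/ℚ) → Ш(E/K)` is injective on `Ш(E/ℚ)[p]` for `p` odd (`[K : ℚ] = 2`; tree theorem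
  `injOn_shaRestriction_torsionBy`, Serre *Galois Cohomology* I.§2.4) — this file's
  `noPTorsion_of_kolyvagin_of_not_dvd_index`, a THEOREM from the two named facts (the certificate
  is the triple (`K`, `y_K`, `p ∤ I_K`), a finite computation with a published correctness proof:
  Gross–Zagier heights / exact `L`-values of the twists);
* or an explicit `p`-descent / `p`-isogeny descent (`#Sel^{(p)}(E/ℚ) = p^{rank}·#E(ℚ)[p]`,
  Schaefer–Stoll 2004), or C.-H. Kim's Kurihara-number structure theorem (Amer. J. Math. 2026,
  RESIDUAL-CASES.md §a.1 row C15, lever L5 — any reduction type at `p ≥ 5` with `ρ̄` onto).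
Nothing here is a class theorem: the certificate is per curve (RESIDUAL-CASES.md lever types L3/L5;
the lane owns verdicts).

**Where it bites (class X11 at `p ≥ 5`, census v3/v4, `N < 10⁴`; `b2b-bsdres-x11a/REPORT.md` §3,
numbers the writer's, lane to certify).** ALL 93 pairs of X11 ∧ `p ≥ 5` have `p ∤ #Ш_an`
(`#Ш_an = 1` at the 10 rank-one pairs; `p ∤ #Ш_an` at the 83 rank-zero pairs). The 5 rank-one pairs
left open after the published sub-class theorems of `Rank1Residual/X11.lean` (Miller `N < 5000`;
Wuthrich Prop. 21 for rank `0`) — `5824c1@7`, `6240be1@5`, `7110m1@5`, `8670u1@5`, `9954j1@7` —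
are therefore "PUBLISHED modulo the per-curve certificate `Ш(E/ℚ)[p] = 0`"
(`X11.bsdp_of_shaAn_unit_of_noPTorsion`). The census records them as "index bound only: Kolyvagin,
`p ∣ I_K`" for the Heegner field tried. Where a Tamagawa number is divisible by `p` — `6240be1@5`
(split multiplicative at `5`, `c_5 = v_5(Δ_min) = 5`), `9954j1@7` (`c_7 = 7`), `8670u1@5`
(`c_2 = v_2(Δ_min) = 10`) — `p ∣ I_K` is forced for EVERY Heegner field granted the BSD shape over
`K` (all `q ∣ N` split in `K`, so `∏_v c_v(E/K) = (∏_q c_q)²` and Gross–Zagier makes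
`I_K / (c_E u_K ∏_q c_q)` the square root of `#Ш(E/K)` up to torsion and powers of `2`), so the
Kolyvagin-index form of the certificate is not expected to exist there (descent / Kurihara numbers
remain); at `5824c1@7` (nonsplit at `7` and `13` with odd valuations: `c_7 = c_13 = 1`) and
`7110m1@5` (`c_5 = 1`, `c_2 = c_79 = 2`) one has `p ∤ ∏_q c_q`, and a Heegner field with `p ∤ I_K`
is predicted to exist (one whose twist has `p ∤ #Ш_an(E^K)`). Numbers: cell job j041184 (PARI) and
`b2b-bsdres-x11b/aprime_side_conditions_j039928.tsv`; lane to certify. These are statements about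
where to look, not verdicts.

**This file proves** (binders: `hGZK` = bsd.S17; `hKo` = `kolyvagin`, `hB` =
`Kolyvagin1990_padicValNat_card_sha_le`, both PUBLISHED named facts of the tree; nothing announced):
* `padicValNat_shaOrder_eq_zero_of_noPTorsion`, `noPTorsion_of_padicValNat_shaOrder_eq_zero` —
  for finite `Ш`: `Ш[p] = 0 ↔ ord_p #Ш = 0` (Cauchy / Lagrange);
* `missingUpperBoundAt_of_noPTorsion`, `missingPPartAt_of_shaAn_unit_of_noPTorsion`,
  `missingPPartAt_iff_noPTorsion_of_shaAn_unit` — the typed currency;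
* `bsdp_of_shaAn_unit_of_noPTorsion` — `BSD(E,p)` in analytic rank `≤ 1` at such a pair;
* `noPTorsion_of_kolyvagin_of_not_dvd_index`, `bsdp_of_kolyvagin_of_not_dvd_index` — the
  Kolyvagin-index form of the certificate and the resulting `BSD(E,p)`;
* `X11.missingInputAt_of_shaAn_unit_of_noPTorsion`, `X11.bsdp_of_shaAn_unit_of_noPTorsion`,
  `X11.bsdp_of_kolyvagin_of_not_dvd_index` — the X11 instances in the cell's canonical shape (on
  X11 ∧ `ram(p)` the surjectivity hypothesis of Kolyvagin's bound is automatic from `irr(p)`,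
  x9's `surj_of_irr_of_ram`, recorded in the docstring; it is kept as a binder here to avoid the
  import).

References: Kolyvagin 1990 [KolyvaginEulerSystems1990]; McCallum 1991 [McCallumLMS1991]; Gross 1991
[GrossLMS1991]; Serre, *Galois Cohomology* I.§2.4 [SerreGaloisCohomology1997]; Miller 2011 §1,
Def. 1.1 [Miller2011LMS]; Schaefer–Stoll, Trans. AMS 356 (2004); C.-H. Kim, Amer. J. Math. (2026)
[Kim2022StructureSelmer]; cell files REFEREE.md R9.3 (the rank-`0` analogue), CLASSES.md.
-/

noncomputable section

open scoped Classical

open WeierstrassCurve Literature.NumberTheory.EllipticCurves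
  Literature.NumberTheory.EllipticCurves.Rank1Residual

namespace Literature.NumberTheory.EllipticCurves.Rank1Residual.Typed

variable (W : WeierstrassCurve ℚ) [W.IsElliptic] (p : ℕ) [Fact p.Prime]

/-! ### `Ш[p] = 0` versus `ord_p #Ш = 0` -/

omit [W.IsElliptic] in
/-- **Certificate ⇒ valuation.** If `Ш(E/ℚ)` is finite and has no nonzero element killed by `p`
(`Ш(E/ℚ)[p] = 0`), then `ord_p #Ш(E/ℚ) = 0` (Cauchy: `p ∣ #Ш` would give an element of order `p`).
[folklore] -/
theorem padicValNat_shaOrder_eq_zero_of_noPTorsion (hfin : W.ShaFinite)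
    (h : ∀ x : W.sha, (p : ℤ) • x = 0 → x = 0) : padicValNat p W.shaOrder = 0 := by
  haveI : Finite W.sha := hfin
  refine padicValNat.eq_zero_of_not_dvd fun hdvd => ?_
  obtain ⟨x, hx⟩ := exists_prime_addOrderOf_dvd_card' (G := W.sha) p hdvd
  have hx0 : x ≠ 0 := by
    intro h0
    rw [h0, addOrderOf_zero] at hx
    exact (Fact.out : p.Prime).one_lt.ne hx
  have hpx : (p : ℤ) • x = 0 := by
    rw [natCast_zsmul, ← hx]
    exact addOrderOf_nsmul_eq_zero x
  exact hx0 (h x hpx)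

omit [W.IsElliptic] in
/-- **Valuation ⇒ certificate.** If `Ш(E/ℚ)` is finite with `ord_p #Ш(E/ℚ) = 0`, then
`Ш(E/ℚ)[p] = 0` (Lagrange: the order of an element killed by `p` divides `p` and `#Ш`).
[folklore] -/
theorem noPTorsion_of_padicValNat_shaOrder_eq_zero (hfin : W.ShaFinite)
    (h : padicValNat p W.shaOrder = 0) : ∀ x : W.sha, (p : ℤ) • x = 0 → x = 0 := by
  haveI : Finite W.sha := hfin
  have hndvd : ¬ p ∣ W.shaOrder := by
    rcases padicValNat.eq_zero_iff.mp h with h1 | h0 | hnd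
    · exact absurd h1 (Fact.out : p.Prime).one_lt.ne'
    · exact absurd h0 (WeierstrassCurve.shaOrder_pos W hfin).ne'
    · exact hnd
  intro x hx
  have hxn : p • x = 0 := by rw [← natCast_zsmul]; exact hx
  have hdiv : addOrderOf x ∣ p := addOrderOf_dvd_of_nsmul_eq_zero hxn
  rcases (Nat.dvd_prime (Fact.out : p.Prime)).mp hdiv with h1 | hp'
  · exact AddMonoid.addOrderOf_eq_one_iff.mp h1
  · exact absurd (hp' ▸ addOrderOf_dvd_natCard x) hndvd

/-! ### The typed currency at a pair with `p ∤ #Ш_an` -/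

omit [W.IsElliptic] in
/-- **The UPPER half from the certificate**: `Ш` finite, `Ш(E/ℚ)[p] = 0`, and `#Ш_an` a rational of
non-negative `p`-adic valuation ⇒ `ord_p #Ш ≤ ord_p #Ш_an` (`MissingUpperBoundAt`).
[cite: Miller2011LMS, Def. 1.1 (arXiv:1010.2431 p. 3)] -/
theorem missingUpperBoundAt_of_noPTorsion (hfin : W.ShaFinite) {q : ℚ} (hq : shaAn W = (q : ℂ))
    (hv : 0 ≤ padicValRat p q) (h : ∀ x : W.sha, (p : ℤ) • x = 0 → x = 0) :
    MissingUpperBoundAt W p := by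
  refine ⟨q, hq, ?_⟩
  rw [padicValNat_shaOrder_eq_zero_of_noPTorsion W p hfin h, Nat.cast_zero]
  exact hv

omit [W.IsElliptic] in
/-- **The whole output from the certificate at a `p`-unit analytic `Ш`**: `Ш` finite,
`#Ш(E/ℚ)_an = q` with `ord_p q = 0`, and `Ш(E/ℚ)[p] = 0` ⇒ `MissingPPartAt W p` (both valuations
are `0`). [cite: Miller2011LMS, Def. 1.1 (arXiv:1010.2431 p. 3)] -/
theorem missingPPartAt_of_shaAn_unit_of_noPTorsion (hfin : W.ShaFinite) {q : ℚ}
    (hq : shaAn W = (q : ℂ)) (hv : padicValRat p q = 0)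
    (h : ∀ x : W.sha, (p : ℤ) • x = 0 → x = 0) : MissingPPartAt W p :=
  ⟨q, hq, by rw [hv, padicValNat_shaOrder_eq_zero_of_noPTorsion W p hfin h, Nat.cast_zero]⟩

omit [W.IsElliptic] in
/-- **At a `p`-unit analytic `Ш` the typed output IS the certificate**: for finite `Ш` and
`#Ш(E/ℚ)_an = q` with `ord_p q = 0`, `MissingPPartAt W p ↔ Ш(E/ℚ)[p] = 0`. So at such pairs the
"missing input" is a finite per-curve computation, not a missing theorem.
[cite: Miller2011LMS, Def. 1.1 (arXiv:1010.2431 p. 3)] -/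
theorem missingPPartAt_iff_noPTorsion_of_shaAn_unit (hfin : W.ShaFinite) {q : ℚ}
    (hq : shaAn W = (q : ℂ)) (hv : padicValRat p q = 0) :
    MissingPPartAt W p ↔ ∀ x : W.sha, (p : ℤ) • x = 0 → x = 0 := by
  refine ⟨fun hm => noPTorsion_of_padicValNat_shaOrder_eq_zero W p hfin ?_,
    missingPPartAt_of_shaAn_unit_of_noPTorsion W p hfin hq hv⟩
  obtain ⟨q', hq', hv'⟩ := hm
  have hqq : q' = q := by exact_mod_cast hq'.symm.trans hq
  subst hqq
  rw [hv] at hv'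
  exact_mod_cast hv'.symm

/-- **`BSD(E,p)` in analytic rank `≤ 1` at a pair with `p ∤ #Ш_an`, from the certificate
`Ш(E/ℚ)[p] = 0`.** Gross–Zagier–Kolyvagin (`hGZK`, bsd.S17) gives `rank = r_an` and `Ш` finite; the
rest is Miller's last clause with both sides of valuation `0`. PUBLISHED inputs + a per-curve
certificate; not a class theorem. [cite: Miller2011LMS, §1 and Def. 1.1] -/
theorem bsdp_of_shaAn_unit_of_noPTorsion (hGZK : rank_eq_analyticRank_of_analyticRank_le_one)
    (hr : W.analyticRank ≤ 1) {q : ℚ} (hq : shaAn W = (q : ℂ)) (hv : padicValRat p q = 0)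
    (h : ∀ x : W.sha, (p : ℤ) • x = 0 → x = 0) : BSDp W p :=
  bsdp_of_missingPPartAt W p hGZK hr
    (missingPPartAt_of_shaAn_unit_of_noPTorsion W p (hGZK W hr).2 hq hv h)

/-! ### Kolyvagin's index certificate -/

/-- **Kolyvagin's index certificate gives `Ш(E/ℚ)[p] = 0`.** Let `K` be an imaginary quadratic field
satisfying the Heegner hypothesis for the level `N`, `y_K = P ∈ E(K)` a Heegner point of infinite
order, `p` an odd prime with `ρ̄_{E,p}` surjective and `p ∤ [E(K) : ℤ y_K]`. Then, granted the two
PUBLISHED named facts `kolyvagin` (Kolyvagin 1990 Thm. A: `Ш(E/K)` finite) and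
`Kolyvagin1990_padicValNat_card_sha_le` (McCallum 1991 §1 / Gross 1991 Thm. 1.3 (2):
`ord_p #Ш(E/K) ≤ 2 ord_p I_K`), one has `ord_p #Ш(E/K) = 0`
(`padicValNat_card_sha_eq_zero_of_not_dvd_index`), so `Ш(E/K)` has no element of order `p`; and the
restriction `Ш(E/ℚ) → Ш(E/K)` is injective on `Ш(E/ℚ)[p]` because `p` is prime to `[K : ℚ] = 2`
(`injOn_shaRestriction_torsionBy`). Hence every `p`-torsion class of `Ш(E/ℚ)` is `0`.
[cite: McCallumLMS1991, §1 Theorem (Kolyvagin), p. 296] [cite: GrossLMS1991, §2 Prop. 2.1 (2)]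
[cite: SerreGaloisCohomology1997, I.§2.4 Cor. to Prop. 9] -/
theorem noPTorsion_of_kolyvagin_of_not_dvd_index {N : ℕ} [NeZero N] {K : Type} [Field K]
    [NumberField K] (hKo : kolyvagin N W K) (hB : Kolyvagin1990_padicValNat_card_sha_le N W K)
    (hK : IsImaginaryQuadratic K) (hH : SatisfiesHeegnerHypothesis N K)
    {P : (W.baseChange K).toAffine.Point} (hP : IsHeegnerPoint N W K P) (hnt : ¬ IsOfFinAddOrder P)
    (hp2 : p ≠ 2) (hρ : W.HasSurjectiveModNGaloisRep p)
    (hI : ¬ p ∣ (AddSubgroup.zmultiples P).index) :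
    ∀ x : W.sha, (p : ℤ) • x = 0 → x = 0 := by
  have hp : p.Prime := Fact.out
  obtain ⟨-, hfinK⟩ := hKo hK hH hP hnt
  haveI : Finite (W.baseChange K).sha := hfinK
  have h0 : padicValNat p (Nat.card (W.baseChange K).sha) = 0 :=
    padicValNat_card_sha_eq_zero_of_not_dvd_index hB hK hH hP hnt hp hp2 hρ hI
  have hndvd : ¬ p ∣ Nat.card (W.baseChange K).sha := by
    rcases padicValNat.eq_zero_iff.mp h0 with h1 | h0' | hnd
    · exact absurd h1 hp.one_lt.ne'
    · exact absurd h0' Nat.card_pos.ne'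
    · exact hnd
  haveI : IsGalois ℚ K := by
    haveI : Algebra.IsQuadraticExtension ℚ K := ⟨hK.1⟩
    infer_instance
  have hcop : p.Coprime (Module.finrank ℚ K) := by
    rw [hK.1]
    exact (Nat.coprime_primes hp Nat.prime_two).mpr hp2
  intro x hx
  have hxn : p • x = 0 := by rw [← natCast_zsmul]; exact hx
  -- the restriction of `x` is killed by `p` in a finite group of order prime to `p`, hence is `0`
  have hres : shaRestriction W K x = 0 := by
    have hpr : p • shaRestriction W K x = 0 := by rw [← map_nsmul, hxn, map_zero]
    have hdiv : addOrderOf (shaRestriction W K x) ∣ p := addOrderOf_dvd_of_nsmul_eq_zero hpr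
    rcases (Nat.dvd_prime hp).mp hdiv with h1 | hp'
    · exact AddMonoid.addOrderOf_eq_one_iff.mp h1
    · exact absurd (hp' ▸ addOrderOf_dvd_natCard (shaRestriction W K x)) hndvd
  -- injectivity of restriction on `Ш(E/ℚ)[p]`
  have hx_mem : x ∈ (AddSubgroup.torsionBy W.sha p : Set W.sha) :=
    AddSubgroup.torsionBy.nsmul_iff.mpr hxn
  have h0_mem : (0 : W.sha) ∈ (AddSubgroup.torsionBy W.sha p : Set W.sha) :=
    AddSubgroup.torsionBy.nsmul_iff.mpr (smul_zero _)
  exact injOn_shaRestriction_torsionBy W K hcop hx_mem h0_mem (by rw [hres, map_zero])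

/-- **`BSD(E,p)` from Kolyvagin's index certificate at a pair with `p ∤ #Ш_an`** (analytic rank
`≤ 1`; PUBLISHED named facts `kolyvagin`, `Kolyvagin1990_padicValNat_card_sha_le`, GZK `hGZK`; the
certificate is the Heegner field `K`, the Heegner point `P` of infinite order and
`p ∤ [E(K) : ℤ P]`, with `p` odd and `ρ̄_{E,p}` surjective). Per curve; not a class theorem.
[cite: McCallumLMS1991, §1 Theorem (Kolyvagin), p. 296] [cite: Miller2011LMS, §1 and Def. 1.1] -/
theorem bsdp_of_kolyvagin_of_not_dvd_index (hGZK : rank_eq_analyticRank_of_analyticRank_le_one)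
    {N : ℕ} [NeZero N] {K : Type} [Field K] [NumberField K] (hKo : kolyvagin N W K)
    (hB : Kolyvagin1990_padicValNat_card_sha_le N W K) (hK : IsImaginaryQuadratic K)
    (hH : SatisfiesHeegnerHypothesis N K) {P : (W.baseChange K).toAffine.Point}
    (hP : IsHeegnerPoint N W K P) (hnt : ¬ IsOfFinAddOrder P) (hp2 : p ≠ 2)
    (hρ : W.HasSurjectiveModNGaloisRep p) (hI : ¬ p ∣ (AddSubgroup.zmultiples P).index)
    (hr : W.analyticRank ≤ 1) {q : ℚ} (hq : shaAn W = (q : ℂ)) (hv : padicValRat p q = 0) :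
    BSDp W p :=
  bsdp_of_shaAn_unit_of_noPTorsion W p hGZK hr hq hv
    (noPTorsion_of_kolyvagin_of_not_dvd_index W p hKo hB hK hH hP hnt hp2 hρ hI)

/-! ### Class X11: the rank-one census pairs at `p ≥ 5` are certificate candidates -/

omit [W.IsElliptic] in
/-- **X11, either rank, `p ∤ #Ш_an`: the typed input of `Typed/X11.lean` is DISCHARGED by the
certificate `Ш(E/ℚ)[p] = 0`** (for finite `Ш`): both components of `X11.MissingInputAt W p` follow
from the whole output `MissingPPartAt W p`. Census (X11 ∧ `p ≥ 5`, `N < 10⁴`): every one of the 93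
pairs has `p ∤ #Ш_an`; the 5 open rank-one pairs `5824c1@7, 6240be1@5, 7110m1@5, 8670u1@5, 9954j1@7`
become per-curve certificate candidates. NOT a class theorem. [cite: Miller2011LMS, Def. 1.1] -/
theorem X11.missingInputAt_of_shaAn_unit_of_noPTorsion (hfin : W.ShaFinite) {q : ℚ}
    (hq : shaAn W = (q : ℂ)) (hv : padicValRat p q = 0)
    (h : ∀ x : W.sha, (p : ℤ) • x = 0 → x = 0) : X11.MissingInputAt W p :=
  have hm : MissingPPartAt W p := missingPPartAt_of_shaAn_unit_of_noPTorsion W p hfin hq hv h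
  ⟨fun _ => X11RankZero.missingInputAt_of_missingPPartAt hm, fun _ => hm⟩

variable [W.IsGloballyMinimal]

/-- **X11 at an odd `p` with `p ∤ #Ш_an`: `BSD(E,p)` from PUBLISHED theorems plus the per-curve
certificate `Ш(E/ℚ)[p] = 0`**, in the cell's canonical shape (through `X11.bsdp_of_missingInputAt`;
named facts Wuthrich Prop. 21 `hW` — idle at such a pair but part of the canonical signature —, GZK
`hGZK`, modularity `hmod`). SUB-class statement (the certificate is per curve); NOT a deletion of
X11.
[cite: Miller2011LMS, §1 and Def. 1.1] [cite: Wuthrich2014, Prop. 21 (p. 400)] -/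
theorem X11.bsdp_of_shaAn_unit_of_noPTorsion (hW : Wuthrich2014.sha_dvd_analyticSha)
    (hGZK : rank_eq_analyticRank_of_analyticRank_le_one) (hmod : hasEntireLFunction_rat)
    (hp : p ≠ 2) (hr : W.analyticRank ≤ 1) (hX : ClassX11 W p) {q : ℚ} (hq : shaAn W = (q : ℂ))
    (hv : padicValRat p q = 0) (h : ∀ x : W.sha, (p : ℤ) • x = 0 → x = 0) : BSDp W p :=
  X11.bsdp_of_missingInputAt hW hGZK hmod W p hp hr hX
    (X11.missingInputAt_of_shaAn_unit_of_noPTorsion W p (hGZK W hr).2 hq hv h)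

/-- **X11 at `p ≥ 5` with `p ∤ #Ш_an` and surjective `ρ̄_{E,p}`: `BSD(E,p)` from PUBLISHED theorems
plus Kolyvagin's index certificate** (`K` Heegner for the level `N`, Heegner point `P` of infinite
order, `p ∤ [E(K) : ℤ P]`; named facts `kolyvagin`, `Kolyvagin1990_padicValNat_card_sha_le`,
Wuthrich Prop. 21 (canonical signature), GZK, modularity). On X11 ∧ `ram(p)` surjectivity is
automatic from `irr(p)` (x9's `surj_of_irr_of_ram`, `Rank1Residual/X9NoEntry.lean`); it is kept as
the binder `hρ`. Census note (module docstring): among the 5 open rank-one pairs only `7110m1@5`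
has `p ∤ ∏ c_q`, the precondition for `p ∤ I_K` to be possible. Per curve; NOT a deletion of X11.
[cite: McCallumLMS1991, §1 Theorem (Kolyvagin), p. 296] [cite: Miller2011LMS, §1 and Def. 1.1] -/
theorem X11.bsdp_of_kolyvagin_of_not_dvd_index (hW : Wuthrich2014.sha_dvd_analyticSha)
    (hGZK : rank_eq_analyticRank_of_analyticRank_le_one) (hmod : hasEntireLFunction_rat)
    {N : ℕ} [NeZero N] {K : Type} [Field K] [NumberField K] (hKo : kolyvagin N W K)
    (hB : Kolyvagin1990_padicValNat_card_sha_le N W K) (hK : IsImaginaryQuadratic K)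
    (hH : SatisfiesHeegnerHypothesis N K) {P : (W.baseChange K).toAffine.Point}
    (hP : IsHeegnerPoint N W K P) (hnt : ¬ IsOfFinAddOrder P) (hp : 5 ≤ p)
    (hρ : W.HasSurjectiveModNGaloisRep p) (hI : ¬ p ∣ (AddSubgroup.zmultiples P).index)
    (hr : W.analyticRank ≤ 1) (hX : ClassX11 W p) {q : ℚ} (hq : shaAn W = (q : ℂ))
    (hv : padicValRat p q = 0) : BSDp W p :=
  X11.bsdp_of_shaAn_unit_of_noPTorsion W p hW hGZK hmod (by omega) hr hX hq hv
    (noPTorsion_of_kolyvagin_of_not_dvd_index W p hKo hB hK hH hP hnt (by omega) hρ hI)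

end Literature.NumberTheory.EllipticCurves.Rank1Residual.Typed
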